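import Mathlib.RingTheory.UniqueFactorizationDomain.Multiplicity
import Mathlib.RingTheory.Localization.FractionRing
import Mathlib.Tactic.LinearCombination
import HarnessLib

/-!
# Unit squares and quadratic norm residues at a dyadic prime `𝔭` with `e(𝔭|2) = 2`, `f(𝔭|2) = 1`
# (`𝓞/𝔭⁵`-arithmetic: the squares of `𝔭`-units are `≡ 1` or `≡ 1 + π² + π³w (mod π⁵)`; a unit `ε` with `π⁴ ‖ ε − 1` is not a
# norm from `F(√(πμ))`; a unit in neither square class is not a square)

Topic `NumberTheory/NumberFields` (namespace = path).  THEOREM-ONLY file (no definition, no named fact, no instance, no `sorry`),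
written by the prover seat `bsd-2adic-k4-w1` GEN 11 (cell `bsd-2adic`; `--supports` stmt-BirchSwinnertonDyer-22615: the parity of
`h(ℚ(P)(√(2+√2)))` — the SECOND cyclotomic layer of a totally real cubic point field `ℚ(P)` of K4's additive census — needs a unit of the
first layer `F = ℚ(P)(√2)` that is not a norm from `F(√(2+√2))`, and the narrow-rank certificate needs a totally positive unit of `F`
that is not a square; both are decided at a dyadic prime of `F` ABOVE the ramified `√2`, where `e = 2`).  Companion of
`DyadicUnitNotNormFromSqrtTwo.lean` (GEN 10: the case `e = 1`, `2 = πw`, squares `≡ 1 (mod π³)`, non-norms `ε ≡ ±3`).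

Purely ring-theoretic statements.  `R` is an integral domain with well-founded divisibility (e.g. the integers of a number field),
`π ∈ R` a PRIME element with `2 = π²·w`, `π ∤ w` («`e = 2`») and `R/(π) = {0, 1}` («`f = 1`»; hypothesis `∀ t, π ∣ t ∨ π ∣ t − 1`).
The local ring at `(π)` is then `ℤ₂[√2]`-like and everything below is the elementary `𝓞/𝔭⁵`-half (`𝔭⁵ = 4𝔭 = 𝔭^{2e+1}`) of the
dyadic Hilbert-symbol calculus (O'Meara §63; Serre Ch. II–III for `ℚ₂`), proved without completions:

* `pow_five_dvd_sq_sub_one_or_sq_sub_of_not_dvd` — for a `π`-unit `a`: `π⁵ ∣ a² − 1` or `π⁵ ∣ a² − q`, `q = 1 + π² + π³w`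
  (`a = 1 + πt`, `a² − 1 = π²t(t + πw)`; the unit squares form exactly two classes modulo `π⁵`).
* `pow_five_dvd_sq_sub_sq_or_eq_sq_mul` — for `π`-units `a, c`: `π⁵ ∣ a² − c²` or `a² − c² = π²ν` with `π ∤ ν`.
* `not_exists_sq_eq_of_not_pow_five_dvd` — a `π`-unit `u` with `π⁵ ∤ u − 1` and `π⁵ ∤ u − q` is not a square in `R`
  (the global consumer: a totally positive unit that is not a square ⟹ `#(U⁺/U²) ≥ 2`).
* `not_exists_sq_sub_mul_sq_of_pow_four_dvd` — if `π⁴ ∣ ε − 1` and `π⁵ ∤ ε − 1` then there are no `a, b, c ∈ R`, `c ≠ 0`, with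
  `a² − πμ·b² = c²ε` (`π ∤ μ`): descent on the power of `π` in `c` (if `π ∣ c` then `π ∣ a`, `π ∣ b` and `π²` cancels), then with
  `π ∤ c`: `c²(ε − 1) = (a² − c²) − πμb²` has `π`-order in `{1, 2, 3} ∪ [5, ∞)` — `1` if `π ∤ b`, `2` or `3` if `π ‖ b`, `2` or `≥ 5`
  if `π² ∣ b` — never exactly `4`.  («A unit `≡ 5 (mod 4√2)` of `ℤ₂[√2]` is not a norm from the ramified extension
  `ℚ₂(√2)(√(√2·unit))`»; with `μ = (2+√2)/π` this is the obstruction `(ε, 2+√2)_𝔭 = −1` used for `ℚ(ζ₁₆)⁺`-layers.)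
* `not_exists_sq_sub_mul_sq_fractionRing_of_pow_four_dvd` — the same with `x, y` in the fraction field: `x² − πμ·y² ≠ ε`, i.e.
  `ε ∉ N(F(√(πμ))ˣ)` (O'Meara 63:10: the norms from `F(√m)` are the values `x² − m y²`).

References: [Omeara1963] §63A–B (63:1, 63:1a — squares of dyadic units modulo `4𝔭`; 63:10 — norms from `F(√m)`);
[Serre1973CourseArithmetic] Ch. II §3.3 and Ch. III §1.2 (the model case `ℚ₂`); [NeukirchANT1999] Ch. V §3 (Hilbert symbols at dyadic places).
-/

namespace Literature.NumberTheory.NumberFields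

variable {R : Type*} [CommRing R]

section Residue

variable {π w : R}

/-- If `R/(π) = {0,1}` and `π ∤ a` then `π ∣ a − 1`. [cite: Omeara1963, §63A (residue field of a dyadic prime)] -/
private theorem dvd_sub_one_of_not_dvd₂ (hres : ∀ t : R, π ∣ t ∨ π ∣ t - 1) {a : R} (ha : ¬ π ∣ a) : π ∣ a - 1 :=
  (hres a).resolve_left ha

/-- **The two classes of unit squares modulo `π⁵` when `2 = π²w`, `π ∤ w`, `R/(π) = {0,1}`**: for every `π`-unit `a`,
`π⁵ ∣ a² − 1` or `π⁵ ∣ a² − (1 + π² + π³w)`.  (`a = 1 + πt`, `a² − 1 = π²·t(t + πw)`; if `π ∣ t` the order is `≥ 5`, if `π ∤ t` then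
`a² − (1 + π² + π³w) = π²(t − 1)(t + 1 + πw)` has order `≥ 5`.)  This is `U² = {u ≡ 1} ∪ {u ≡ 1 + π² + π³w} (mod 𝔭^{2e+1})` for `e = 2`,
`f = 1`. [cite: Omeara1963, §63A (63:1, 63:1a: squares of units modulo `4𝔭`)] [cite: Serre1973CourseArithmetic, Ch. II §3.3 (the model case `ℤ₂`)] -/
theorem pow_five_dvd_sq_sub_one_or_sq_sub_of_not_dvd (h2 : (2 : R) = π ^ 2 * w) (hw : ¬ π ∣ w)
    (hres : ∀ t : R, π ∣ t ∨ π ∣ t - 1) {a : R} (ha : ¬ π ∣ a) :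
    π ^ 5 ∣ a ^ 2 - 1 ∨ π ^ 5 ∣ a ^ 2 - (1 + π ^ 2 + π ^ 3 * w) := by
  obtain ⟨t, ht⟩ := dvd_sub_one_of_not_dvd₂ hres ha
  obtain ⟨v, hv⟩ := dvd_sub_one_of_not_dvd₂ hres hw
  have ha' : a = 1 + π * t := by linear_combination ht
  -- `a² − 1 = π² t (t + π w)`
  have hsq : a ^ 2 - 1 = π ^ 2 * (t * (t + π * w)) := by rw [ha']; linear_combination (π * t) * h2
  rcases hres t with ⟨t₁, rfl⟩ | ⟨t₂, ht₂⟩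
  · -- `π ∣ t`: `a² − 1 = π⁴ t₁ (t₁ + w)`
    left
    rcases hres t₁ with ⟨t₃, rfl⟩ | ⟨t₃, ht₃⟩
    · exact ⟨t₃ * (π * t₃ + w), by linear_combination hsq⟩
    · -- `t₁ + w ≡ 1 + 1 = 2 ≡ 0`
      exact ⟨t₁ * (t₃ + v + π * w), by linear_combination hsq + (π ^ 4 * t₁) * ht₃ + (π ^ 4 * t₁) * hv + (π ^ 4 * t₁) * h2⟩
  · -- `π ∤ t`, `t = 1 + π t₂`: `a² − q = π⁴ t₂ (π w + t₂ + w)`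
    right
    have ht' : t = 1 + π * t₂ := by linear_combination ht₂
    have hq : a ^ 2 - (1 + π ^ 2 + π ^ 3 * w) = π ^ 4 * (t₂ * (π * w + t₂ + w)) := by
      rw [ht'] at hsq; linear_combination hsq + (π ^ 3 * t₂) * h2
    rcases hres t₂ with ⟨t₃, rfl⟩ | ⟨t₃, ht₃⟩
    · exact ⟨t₃ * (π * w + π * t₃ + w), by linear_combination hq⟩
    · exact ⟨t₂ * (w + t₃ + v + π * w), by linear_combination hq + (π ^ 4 * t₂) * ht₃ + (π ^ 4 * t₂) * hv + (π ^ 4 * t₂) * h2⟩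

/-- **For two `π`-units `a, c`: `π⁵ ∣ a² − c²`, or `a² − c² = π²·ν` with `π ∤ ν`** (same square class, or the two classes
`1`, `1 + π² + π³w` whose difference `π²(1 + πw)` has exact order `2`). [cite: Omeara1963, §63A (63:1a)] -/
theorem pow_five_dvd_sq_sub_sq_or_eq_sq_mul (hπ : Prime π) (h2 : (2 : R) = π ^ 2 * w) (hw : ¬ π ∣ w)
    (hres : ∀ t : R, π ∣ t ∨ π ∣ t - 1) {a c : R} (ha : ¬ π ∣ a) (hc : ¬ π ∣ c) :
    π ^ 5 ∣ a ^ 2 - c ^ 2 ∨ ∃ ν : R, a ^ 2 - c ^ 2 = π ^ 2 * ν ∧ ¬ π ∣ ν := by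
  have hone : ∀ (x : R), ¬ π ∣ 1 + π * x := fun x ⟨y, hy⟩ =>
    hπ.not_unit (isUnit_of_dvd_one ⟨y - x, by linear_combination hy⟩)
  rcases pow_five_dvd_sq_sub_one_or_sq_sub_of_not_dvd h2 hw hres ha with ⟨k, hk⟩ | ⟨k, hk⟩ <;>
    rcases pow_five_dvd_sq_sub_one_or_sq_sub_of_not_dvd h2 hw hres hc with ⟨k', hk'⟩ | ⟨k', hk'⟩
  · exact Or.inl ⟨k - k', by linear_combination hk - hk'⟩
  · refine Or.inr ⟨-(1 + π * (w + π ^ 2 * (k' - k))), by linear_combination hk - hk', fun h => hone _ ((dvd_neg).mp h)⟩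
  · refine Or.inr ⟨1 + π * (w + π ^ 2 * (k - k')), by linear_combination hk - hk', fun h => hone _ h⟩
  · exact Or.inl ⟨k - k', by linear_combination hk - hk'⟩

/-- **A `π`-unit in neither square class is not a square**: if `π ∤ u`, `π⁵ ∤ u − 1` and `π⁵ ∤ u − (1 + π² + π³w)` then `u ≠ a²`
for all `a ∈ R`.  (Consumer: a totally positive unit `u` of a real field with such residues at one dyadic prime of ramification index
`2` and degree `1` is not the square of a unit, so `#(U⁺/U²) ≥ 2`.) [cite: Omeara1963, §63A (63:1a)] -/
theorem not_exists_sq_eq_of_not_pow_five_dvd (h2 : (2 : R) = π ^ 2 * w) (hw : ¬ π ∣ w)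
    (hres : ∀ t : R, π ∣ t ∨ π ∣ t - 1) {u : R} (hu : ¬ π ∣ u) (h1 : ¬ π ^ 5 ∣ u - 1)
    (hq : ¬ π ^ 5 ∣ u - (1 + π ^ 2 + π ^ 3 * w)) : ¬ ∃ a : R, a ^ 2 = u := by
  rintro ⟨a, rfl⟩
  have ha : ¬ π ∣ a := fun h => hu (dvd_pow h two_ne_zero)
  rcases pow_five_dvd_sq_sub_one_or_sq_sub_of_not_dvd h2 hw hres ha with h | h
  · exact h1 h
  · exact hq h

end Residue

section Descent

variable [IsDomain R] [WfDvdMonoid R] {π w μ ε : R}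

/-- **A unit `ε` with `π⁴ ‖ ε − 1` is not `a² − πμ·b²` up to squares: no `a, b, c ∈ R`, `c ≠ 0`, with `a² − πμb² = c²ε`**
(`π` prime, `2 = π²w`, `π ∤ w`, `R/(π) = {0,1}`, `π ∤ μ`).  Descent on the power of `π` in `c`; then for `π ∤ c`,
`c²(ε − 1) = (a² − c²) − πμb²` has `π`-order `1` (`π ∤ b`), `2` or `3` (`π ‖ b`), `2` or `≥ 5` (`π² ∣ b`) — never `4`.
In Hilbert-symbol language: `(ε, πμ)_𝔭 = −1` for `ε ≡ 1 + π⁴ (mod π⁵)` at a dyadic prime with `e = 2`, `f = 1`; only this elementary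
direction is proved, without completions. [cite: Omeara1963, §63B (63:10) and §63A (63:1)] [cite: NeukirchANT1999, Ch. V §3] -/
theorem not_exists_sq_sub_mul_sq_of_pow_four_dvd (hπ : Prime π) (h2 : (2 : R) = π ^ 2 * w) (hw : ¬ π ∣ w)
    (hres : ∀ t : R, π ∣ t ∨ π ∣ t - 1) (hμ : ¬ π ∣ μ) (h4 : π ^ 4 ∣ ε - 1) (h5 : ¬ π ^ 5 ∣ ε - 1) :
    ¬ ∃ a b c : R, c ≠ 0 ∧ a ^ 2 - π * μ * b ^ 2 = c ^ 2 * ε := by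
  rintro ⟨a, b, c, hc, h⟩
  have hπ0 : π ≠ 0 := hπ.ne_zero
  -- `π ∤ ε`
  have hε : ¬ π ∣ ε := by
    intro hε
    have h1 : π ∣ ε - 1 := (dvd_pow_self π (by norm_num)).trans h4
    have h1' : π ∣ (1 : R) := by
      have := dvd_sub hε h1
      rwa [sub_sub_cancel] at this
    exact hπ.not_unit (isUnit_of_dvd_one h1')
  have hndvd_of : ∀ {x : R}, π ∣ x - 1 → ¬ π ∣ x := by
    rintro x ⟨s, hs⟩ ⟨s', hs'⟩
    exact hπ.not_unit (IsUnit.of_mul_eq_one (s' - s) (by linear_combination hs - hs'))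
  obtain ⟨k, c', hc', rfl⟩ := WfDvdMonoid.max_power_factor' hc hπ.not_unit
  induction k generalizing a b with
  | zero =>
    rw [pow_zero, one_mul] at h
    -- `π ∤ a`
    have ha : ¬ π ∣ a := by
      intro hpa
      have h1 : π ∣ c' ^ 2 * ε := by
        rw [← h]
        exact dvd_sub (dvd_pow hpa two_ne_zero) (Dvd.intro (μ * b ^ 2) (by ring))
      rcases hπ.dvd_or_dvd h1 with h3 | h3
      · exact hc' (hπ.dvd_of_dvd_pow h3)
      · exact hε h3
    -- `Δ = c'²(ε − 1) = (a² − c'²) − πμ b²`, `π⁴ ∣ Δ`, `π⁵ ∤ Δ`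
    have hΔ : c' ^ 2 * (ε - 1) = (a ^ 2 - c' ^ 2) - π * μ * b ^ 2 := by linear_combination -h
    have h4Δ : π ^ 4 ∣ (a ^ 2 - c' ^ 2) - π * μ * b ^ 2 := by rw [← hΔ]; exact h4.mul_left _
    have h5Δ : ¬ π ^ 5 ∣ (a ^ 2 - c' ^ 2) - π * μ * b ^ 2 := by
      rw [← hΔ]
      exact fun h5' => h5 (hπ.pow_dvd_of_dvd_mul_left 5 hc' (hπ.pow_dvd_of_dvd_mul_left 5 hc' (by rwa [sq, mul_assoc] at h5')))
    -- `π ∣ μ b'² ⟹ π ∣ b'`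
    have hμb : ∀ {b' : R}, π ∣ μ * b' ^ 2 → π ∣ b' := by
      intro b' h3'
      rcases hπ.dvd_or_dvd h3' with h6 | h6
      · exact absurd h6 hμ
      · exact hπ.dvd_of_dvd_pow h6
    rcases pow_five_dvd_sq_sub_sq_or_eq_sq_mul hπ h2 hw hres ha hc' with hD | ⟨ν, hν, hνn⟩
    · -- same square class: `π⁵ ∣ a² − c'²`
      rcases hres b with ⟨b₁, rfl⟩ | hb
      · rcases hres b₁ with ⟨b₂, rfl⟩ | hb₁
        · -- `π² ∣ b`: `π⁵ ∣ Δ`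
          exact h5Δ (dvd_sub hD ⟨μ * b₂ ^ 2, by ring⟩)
        · -- `π ‖ b`: `π⁴ ∣ π³ μ b₁²` forces `π ∣ μ b₁²`
          have h3 : π ^ 4 ∣ π * μ * (π * b₁) ^ 2 := by
            have := dvd_sub ((pow_dvd_pow π (by norm_num : 4 ≤ 5)).trans hD) h4Δ
            rwa [sub_sub_cancel] at this
          have h3' : π ∣ μ * b₁ ^ 2 := by
            rw [show π * μ * (π * b₁) ^ 2 = π ^ 3 * (μ * b₁ ^ 2) by ring, show π ^ 4 = π ^ 3 * π by ring] at h3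
            exact (mul_dvd_mul_iff_left (pow_ne_zero 3 hπ0)).mp h3
          exact hndvd_of hb₁ (hμb h3')
      · -- `π ∤ b`: `π² ∣ a² − c'²` and `π² ∣ Δ` give `π ∣ μ b²`
        have h3 : π ^ 2 ∣ π * μ * b ^ 2 := by
          have := dvd_sub ((pow_dvd_pow π (by norm_num : 2 ≤ 5)).trans hD) ((pow_dvd_pow π (by norm_num : 2 ≤ 4)).trans h4Δ)
          rwa [sub_sub_cancel] at this
        have h3' : π ∣ μ * b ^ 2 := by
          rw [show π * μ * b ^ 2 = π * (μ * b ^ 2) by ring, sq] at h3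
          exact (mul_dvd_mul_iff_left hπ0).mp h3
        exact hndvd_of hb (hμb h3')
    · -- different square classes: `a² − c'² = π² ν`, `π ∤ ν`
      rw [hν] at h4Δ h5Δ
      rcases hres b with ⟨b₁, rfl⟩ | hb
      · rcases hres b₁ with ⟨b₂, rfl⟩ | hb₁
        · -- `π² ∣ b`: `π⁴ ∣ π²(ν − π³ μ b₂²)` forces `π ∣ ν`
          apply hνn
          have h3 : π ^ 2 * π ^ 2 ∣ π ^ 2 * (ν - π ^ 3 * μ * b₂ ^ 2) := by
            rw [show π ^ 2 * ν - π * μ * (π * (π * b₂)) ^ 2 = π ^ 2 * (ν - π ^ 3 * μ * b₂ ^ 2) by ring,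
              show π ^ 4 = π ^ 2 * π ^ 2 by ring] at h4Δ
            exact h4Δ
          have h3' : π ^ 2 ∣ ν - π ^ 3 * μ * b₂ ^ 2 := (mul_dvd_mul_iff_left (pow_ne_zero 2 hπ0)).mp h3
          have h6 : π ∣ ν - π ^ 3 * μ * b₂ ^ 2 := (dvd_pow_self π two_ne_zero).trans h3'
          have h7 := dvd_add h6 (Dvd.intro (π ^ 2 * μ * b₂ ^ 2) (by ring) : π ∣ π ^ 3 * μ * b₂ ^ 2)
          rwa [sub_add_cancel] at h7
        · -- `π ‖ b`: `π⁴ ∣ π²(ν − π μ b₁²)` forces `π ∣ ν`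
          apply hνn
          have h3 : π ^ 2 * π ^ 2 ∣ π ^ 2 * (ν - π * μ * b₁ ^ 2) := by
            rw [show π ^ 2 * ν - π * μ * (π * b₁) ^ 2 = π ^ 2 * (ν - π * μ * b₁ ^ 2) by ring,
              show π ^ 4 = π ^ 2 * π ^ 2 by ring] at h4Δ
            exact h4Δ
          have h3' : π ^ 2 ∣ ν - π * μ * b₁ ^ 2 := (mul_dvd_mul_iff_left (pow_ne_zero 2 hπ0)).mp h3
          have h6 : π ∣ ν - π * μ * b₁ ^ 2 := (dvd_pow_self π two_ne_zero).trans h3'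
          have h7 := dvd_add h6 (Dvd.intro (μ * b₁ ^ 2) (by ring) : π ∣ π * μ * b₁ ^ 2)
          rwa [sub_add_cancel] at h7
      · -- `π ∤ b`: `π² ∣ Δ` and `π² ∣ π²ν` give `π ∣ μ b²`
        have h3 : π ^ 2 ∣ π * μ * b ^ 2 := by
          have := dvd_sub (Dvd.intro ν rfl : π ^ 2 ∣ π ^ 2 * ν) ((pow_dvd_pow π (by norm_num : 2 ≤ 4)).trans h4Δ)
          rwa [sub_sub_cancel] at this
        have h3' : π ∣ μ * b ^ 2 := by
          rw [show π * μ * b ^ 2 = π * (μ * b ^ 2) by ring, sq] at h3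
          exact (mul_dvd_mul_iff_left hπ0).mp h3
        exact hndvd_of hb (hμb h3')
  | succ k ih =>
    -- `π ∣ a`
    have hpa : π ∣ a := by
      have h1 : π ∣ a ^ 2 := ⟨μ * b ^ 2 + π ^ (2 * k + 1) * c' ^ 2 * ε, by linear_combination h⟩
      exact hπ.dvd_of_dvd_pow h1
    obtain ⟨a', rfl⟩ := hpa
    -- `π ∣ b`
    have hpb : π ∣ b := by
      have h1 : π ∣ μ * b ^ 2 := by
        refine ⟨a' ^ 2 - π ^ (2 * k) * c' ^ 2 * ε, ?_⟩
        have h3 : π * (μ * b ^ 2) = π * (π * (a' ^ 2 - π ^ (2 * k) * c' ^ 2 * ε)) := by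
          linear_combination (-1 : R) * h
        exact mul_left_cancel₀ hπ.ne_zero h3
      rcases hπ.dvd_or_dvd h1 with h3 | h3
      · exact absurd h3 hμ
      · exact hπ.dvd_of_dvd_pow h3
    obtain ⟨b', rfl⟩ := hpb
    refine ih (a := a') (b := b') (mul_ne_zero (pow_ne_zero _ hπ.ne_zero) (right_ne_zero_of_mul hc)) ?_
    have h3 : π ^ 2 * (a' ^ 2 - π * μ * b' ^ 2) = π ^ 2 * ((π ^ k * c') ^ 2 * ε) := by linear_combination h
    exact mul_left_cancel₀ (pow_ne_zero 2 hπ.ne_zero) h3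

end Descent

section Field

variable [IsDomain R] [WfDvdMonoid R] {π w μ ε : R} (K : Type*) [Field K] [Algebra R K] [IsFractionRing R K]

omit [WfDvdMonoid R] in
/-- Clearing denominators: `x² − m y² = ε` in the fraction field gives `a² − m b² = c²ε` in `R` with `c ≠ 0`. [folklore] -/
private theorem exists_sq_sub_mul_sq_of_field {m : R} {x y : K}
    (h : x ^ 2 - algebraMap R K m * y ^ 2 = algebraMap R K ε) :
    ∃ a b c : R, c ≠ 0 ∧ a ^ 2 - m * b ^ 2 = c ^ 2 * ε := by
  obtain ⟨a₁, d₁, hd₁, hx⟩ := IsFractionRing.div_surjective (A := R) x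
  obtain ⟨a₂, d₂, hd₂, hy⟩ := IsFractionRing.div_surjective (A := R) y
  have hd₁0 : d₁ ≠ 0 := nonZeroDivisors.ne_zero hd₁
  have hd₂0 : d₂ ≠ 0 := nonZeroDivisors.ne_zero hd₂
  have hd₁K : algebraMap R K d₁ ≠ 0 := IsFractionRing.to_map_ne_zero_of_mem_nonZeroDivisors hd₁
  have hd₂K : algebraMap R K d₂ ≠ 0 := IsFractionRing.to_map_ne_zero_of_mem_nonZeroDivisors hd₂
  refine ⟨a₁ * d₂, a₂ * d₁, d₁ * d₂, mul_ne_zero hd₁0 hd₂0, ?_⟩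
  have hx' : algebraMap R K a₁ = x * algebraMap R K d₁ := by rw [← hx, div_mul_cancel₀ _ hd₁K]
  have hy' : algebraMap R K a₂ = y * algebraMap R K d₂ := by rw [← hy, div_mul_cancel₀ _ hd₂K]
  apply IsFractionRing.injective R K
  simp only [map_sub, map_mul, map_pow]
  rw [hx', hy']
  linear_combination (algebraMap R K d₁ * algebraMap R K d₂) ^ 2 * h

/-- **Field form: a unit `ε` of `R` with `π⁴ ‖ ε − 1` is not of the form `x² − πμ·y²` with `x, y` in the fraction field `K` of `R`**
(`π` prime, `2 = π²w`, `π ∤ w`, `R/(π) = {0,1}`, `π ∤ μ`) — `ε` is not a norm from `K(√(πμ))` (O'Meara 63:10); the dyadic obstruction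
`(ε, πμ)_𝔭 = −1` at a prime with `e(𝔭|2) = 2`, `f(𝔭|2) = 1`. [cite: Omeara1963, §63B (63:10) and §63A (63:1)] [cite: NeukirchANT1999, Ch. V §3] -/
theorem not_exists_sq_sub_mul_sq_fractionRing_of_pow_four_dvd (hπ : Prime π) (h2 : (2 : R) = π ^ 2 * w)
    (hw : ¬ π ∣ w) (hres : ∀ t : R, π ∣ t ∨ π ∣ t - 1) (hμ : ¬ π ∣ μ) (h4 : π ^ 4 ∣ ε - 1) (h5 : ¬ π ^ 5 ∣ ε - 1) :
    ¬ ∃ x y : K, x ^ 2 - algebraMap R K (π * μ) * y ^ 2 = algebraMap R K ε := by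
  rintro ⟨x, y, h⟩
  obtain ⟨a, b, c, hc, habc⟩ := exists_sq_sub_mul_sq_of_field K h
  exact not_exists_sq_sub_mul_sq_of_pow_four_dvd hπ h2 hw hres hμ h4 h5 ⟨a, b, c, hc, by linear_combination habc⟩

end Field

end Literature.NumberTheory.NumberFields
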